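import Summits.ValiantsHypothesis.ValiantsHypothesis.Theses.SymPencil
import Summits.ValiantsHypothesis.ValiantsHypothesis.Theorems.HubHub

/-!
# ValiantsHypothesis / SymPencil — `HubPerNotVp` (shared permanent hub)

Route `SymPencil`, item `stmt-ValiantsHypothesis-0317` (support, rank 9; the same statement is the
hub item of the routes `Depth4`, `Elusive`, `SummationBits`, `FreeEnergyLift`, …): if the permanent
family `(per_n)_n` over `ℂ` is not a `VP` family (unbundled `IsVPFamily` form), then — given the
renaming bridge `perFamily ℂ ∈ VP ℂ ↔ IsVPFamily (fun n => perPoly (Fin n) ℂ)` and Valiant's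
theorem `perFamily ℂ ∈ VNP ℂ` as hypotheses — Valiant's hypothesis `VP_ℂ ≠ VNP_ℂ` holds.

Pure bookkeeping: the body of the route declaration is, verbatim, the statement of the tree lemma
`Summit.ValiantsHypothesis.Hub.valiantsHypothesis_of_not_isVPFamily_per` (`Theorems/HubHub.lean`),
so the proof unfolds the route declaration and applies that lemma. Nothing else is here.
-/

-- `Summit.ValiantsHypothesis.ValiantsHypothesis.…` is the tree's mandated single-conjunct layout
-- (Sub = Summit), so the duplicated namespace component is intended.
set_option linter.dupNamespace false

namespace Summit.ValiantsHypothesis.ValiantsHypothesis.Theorems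

/-- Settles `stmt-ValiantsHypothesis-0317` (`HubPerNotVp`, route `SymPencil`):
`¬ IsVPFamily_ℂ (per_n) → (perFamily ℂ ∈ VP ℂ ↔ IsVPFamily_ℂ (per_n)) → perFamily ℂ ∈ VNP ℂ →
ValiantsHypothesis`. If `VP ℂ = VNP ℂ` then `perFamily ℂ ∈ VNP ℂ = VP ℂ`, and the renaming bridge
turns this into `IsVPFamily (fun n => perPoly (Fin n) ℂ)`, contradicting the first hypothesis;
this is exactly `Summit.ValiantsHypothesis.Hub.valiantsHypothesis_of_not_isVPFamily_per`.
[folklore] -/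
theorem hubPerNotVp_proof :
    Summit.ValiantsHypothesis.ValiantsHypothesis.Theses.SymPencil.HubPerNotVp := by
  unfold Summit.ValiantsHypothesis.ValiantsHypothesis.Theses.SymPencil.HubPerNotVp
  exact Summit.ValiantsHypothesis.Hub.valiantsHypothesis_of_not_isVPFamily_per

end Summit.ValiantsHypothesis.ValiantsHypothesis.Theorems
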